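import Summits.CriticalPhenomena.PercolationContinuityZ3.Theorems.PercNearOneGluingNoHeavyLowerTailSunflowerGradedSafe
import HarnessLib

/-!
# `NoHeavyLowerTail` (crux stmt-CriticalPhenomena-4575), abstract sunflower cubic: TRANSPORT OF SAFETY ALONG AN EMBEDDING OF CUBES

Support file (seat `prim-ineq-prove-1` gen 38; `--supports stmt-CriticalPhenomena-4575`).  No `sorry`, no named facts.
Memo: run/shared/lean/prim/prim-ineq-prove-1/FINDING-BERNSTEIN-prove1-g38.md §5.

Concrete cores are certified SAFE on their own small cube (`Fan.safe_core` on `Fin 4`, `PathFive.safe_core` and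
`Pentagon.safe_core` on `Fin 5`, …SunflowerBernsteinPathFive / …Pentagon), while the calculus (`safe_inter`, `safe_union_of_gsafe`, …)
speaks of events on a common big cube `Set ι` determined by blocks.  This file bridges the two:
* `cylEv f A₀` — the cylinder of an event `A₀ ⊆ Set (Fin n)` along an embedding `f : Fin n ↪ ι` (`{ω | f⁻¹ ω ∈ A₀}`), determined by
  the block `univ.map f`; `restrEv f W` — the pull-back `{ω₀ | f '' ω₀ ∈ W}` of an event of the big cube;
* **`real_restrEv`** — for `W` determined by the block, `μ_p(W) = μ_{p ∘ f}(restrEv f W)` (block expectation `BEx_indicator_eq_real`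
  on both sides + reindexing the missing sets by `Finset.map f`); `real_cylEv`;
* **`safe_cylEv`** — `Safe (p ∘ f) A₀ → Safe p (cylEv f A₀)` (enlarge each petal to `capIn` of the block, pull back).
So every `∀ p, Safe p core` proved on a small cube holds for the corresponding cylinder core in any ambient cube.
-/

noncomputable section

namespace Summit.CriticalPhenomena.PercolationContinuityZ3.Theorems.SunflowerPartition

namespace SafeCalc

open MeasureTheory Finset
open Literature.Probability.LatticeModels Literature.Probability.Percolation
open TwoGenCore (wmiss)

variable {ι : Type*} {n : ℕ}

/-- The cylinder of an event of the small cube along an embedding of coordinates. [this work] -/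
def cylEv (f : Fin n ↪ ι) (A₀ : Set (Set (Fin n))) : Set (Set ι) := {ω | {i | f i ∈ ω} ∈ A₀}

/-- The pull-back of an event of the big cube to the small cube. [this work] -/
def restrEv (f : Fin n ↪ ι) (W : Set (Set ι)) : Set (Set (Fin n)) := {ω₀ | f '' ω₀ ∈ W}

/-- The cylinder event is determined by the block `univ.map f`. [this work] -/
theorem determinedBy_cylEv (f : Fin n ↪ ι) (A₀ : Set (Set (Fin n))) :
    DeterminedBy (cylEv f A₀) (↑((univ : Finset (Fin n)).map f) : Set ι) := by
  rw [determinedBy_iff]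
  intro ω ω' h
  have key : ∀ i : Fin n, f i ∈ ω ↔ f i ∈ ω' := by
    intro i
    have hi : f i ∈ (↑((univ : Finset (Fin n)).map f) : Set ι) := by simp
    exact ⟨fun h1 => ((Set.ext_iff.1 h (f i)).1 ⟨h1, hi⟩).1, fun h1 => ((Set.ext_iff.1 h (f i)).2 ⟨h1, hi⟩).1⟩
  simp only [cylEv, Set.mem_setOf_eq]
  have : {i | f i ∈ ω} = {i | f i ∈ ω'} := Set.ext fun i => key i
  rw [this]

/-- The cylinder of an up-set is an up-set. [this work] -/
theorem isUpperSet_cylEv (f : Fin n ↪ ι) {A₀ : Set (Set (Fin n))} (hA : IsUpperSet A₀) : IsUpperSet (cylEv f A₀) :=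
  fun _ _ hle h => hA (fun _ hi => hle hi) h

/-- The pull-back of an up-set is an up-set. [this work] -/
theorem isUpperSet_restrEv (f : Fin n ↪ ι) {W : Set (Set ι)} (hW : IsUpperSet W) : IsUpperSet (restrEv f W) :=
  fun _ _ hle h => hW (Set.image_mono hle) h

/-- Pulling back the cylinder gives back the event. [this work] -/
theorem restrEv_cylEv (f : Fin n ↪ ι) (A₀ : Set (Set (Fin n))) : restrEv f (cylEv f A₀) = A₀ := by
  ext ω₀
  simp only [restrEv, cylEv, Set.mem_setOf_eq]
  have : {i | f i ∈ f '' ω₀} = ω₀ := by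
    ext i
    simp only [Set.mem_setOf_eq, Set.mem_image]
    exact ⟨fun ⟨j, hj, hji⟩ => f.injective hji ▸ hj, fun hi => ⟨i, hi, rfl⟩⟩
  rw [this]

/-- Every event of the small cube is determined by the whole cube. [this work] -/
theorem determinedBy_univ (B : Set (Set (Fin n))) : DeterminedBy B (↑(univ : Finset (Fin n)) : Set (Fin n)) := by
  rw [determinedBy_iff]
  intro ω ω' h
  rw [coe_univ, Set.inter_univ, Set.inter_univ] at h
  rw [h]

/-- Cylinder weights transport along the embedding. [this work] -/
theorem wmiss_map [DecidableEq ι] (p : ι → unitInterval) (f : Fin n ↪ ι) (T₀ : Finset (Fin n)) :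
    wmiss p ((univ : Finset (Fin n)).map f) (T₀.map f) = wmiss (fun i => p (f i)) univ T₀ := by
  unfold TwoGenCore.wmiss
  rw [← map_sdiff, prod_map, prod_map]

/-- The block point of a transported missing set, pulled back. [this work] -/
theorem coe_map_sdiff_mem_iff [DecidableEq ι] (f : Fin n ↪ ι) (W : Set (Set ι)) (T₀ : Finset (Fin n)) :
    ((((univ : Finset (Fin n)).map f \ T₀.map f : Finset ι)) : Set ι) ∈ W ↔
      (((univ \ T₀ : Finset (Fin n))) : Set (Fin n)) ∈ restrEv f W := by
  rw [restrEv, Set.mem_setOf_eq, ← map_sdiff, coe_map]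

/-- Reindexing a sum over the missing sets of the block `univ.map f` by the missing sets of the small cube. [this work] -/
theorem sum_powerset_map (f : Fin n ↪ ι) (G : Finset ι → ℝ) :
    ∑ T ∈ ((univ : Finset (Fin n)).map f).powerset, G T = ∑ T₀ ∈ (univ : Finset (Fin n)).powerset, G (T₀.map f) := by
  classical
  refine (sum_nbij' (fun T₀ : Finset (Fin n) => T₀.map f) (fun T : Finset ι => T.preimage f f.injective.injOn)
    ?_ ?_ ?_ ?_ fun _ _ => rfl).symm
  · intro T₀ _; rw [mem_powerset]; exact map_subset_map.2 (subset_univ _)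
  · intro T _; rw [mem_powerset]; exact subset_univ _
  · intro T₀ _
    ext i; simp
  · intro T hT
    rw [mem_powerset] at hT
    ext x
    simp only [mem_map, mem_preimage]
    constructor
    · rintro ⟨i, hi, rfl⟩; exact hi
    · intro hx
      obtain ⟨i, -, rfl⟩ := mem_map.1 (hT hx)
      exact ⟨i, hx, rfl⟩

/-- **Measure transport**: an event determined by the block `univ.map f` has the probability of its pull-back under the pulled-back
parameters. [this work] -/
theorem real_restrEv [Fintype ι] [DecidableEq ι] (p : ι → unitInterval) (f : Fin n ↪ ι) {W : Set (Set ι)}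
    (hW : DeterminedBy W (↑((univ : Finset (Fin n)).map f) : Set ι)) :
    (prodBernoulli p).real W = (prodBernoulli fun i => p (f i)).real (restrEv f W) := by
  classical
  rw [← BEx_indicator_eq_real p hW, ← BEx_indicator_eq_real (fun i => p (f i)) (determinedBy_univ (restrEv f W))]
  unfold BEx
  rw [sum_powerset_map]
  refine sum_congr rfl fun T₀ _ => ?_
  dsimp only
  rw [wmiss_map]
  congr 1
  simp only [coe_map_sdiff_mem_iff]

/-- The probability of a cylinder event. [this work] -/
theorem real_cylEv [Fintype ι] [DecidableEq ι] (p : ι → unitInterval) (f : Fin n ↪ ι) (A₀ : Set (Set (Fin n))) :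
    (prodBernoulli p).real (cylEv f A₀) = (prodBernoulli fun i => p (f i)).real A₀ := by
  rw [real_restrEv p f (determinedBy_cylEv f A₀), restrEv_cylEv]

/-- **Transport of safety**: if `A₀` is safe on the small cube for the pulled-back parameters, its cylinder is safe on the big
cube. [this work] -/
theorem safe_cylEv [Fintype ι] [DecidableEq ι] (p : ι → unitInterval) (f : Fin n ↪ ι) {A₀ : Set (Set (Fin n))}
    (h : Safe (fun i => p (f i)) A₀) : Safe p (cylEv f A₀) := by
  classical
  intro k V hV hcap
  set a : Finset ι := (univ : Finset (Fin n)).map f with ha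
  have hdA : DeterminedBy (cylEv f A₀) (↑a : Set ι) := determinedBy_cylEv f A₀
  -- enlarge the petals to events determined by the block
  have hIn : ∀ i j, i ≠ j → capIn a (V i) ∩ capIn a (V j) ⊆ cylEv f A₀ := by
    intro i j hij
    rw [← capIn_inter, ← capIn_eq_of_determinedBy a hdA]
    exact capIn_mono a (hcap i j hij)
  -- pull back to the small cube
  let V₀ : Fin k → Set (Set (Fin n)) := fun i => restrEv f (capIn a (V i))
  have hV₀ : ∀ i, IsUpperSet (V₀ i) := fun i => isUpperSet_restrEv f (isUpperSet_capIn a (hV i))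
  have hcap₀ : ∀ i j, i ≠ j → V₀ i ∩ V₀ j ⊆ A₀ := by
    intro i j hij ω₀ hω
    have h1 : f '' ω₀ ∈ capIn a (V i) ∩ capIn a (V j) := hω
    have h2 := hIn i j hij h1
    rw [← restrEv_cylEv f A₀]
    exact h2
  have key := h k V₀ hV₀ hcap₀
  have hre : ∀ i, (prodBernoulli p).real (capIn a (V i)) = (prodBernoulli fun i => p (f i)).real (V₀ i) :=
    fun i => real_restrEv p f (determinedBy_capIn a (V i))
  calc ∏ i, (prodBernoulli p).real (V i) ≤ ∏ i, (prodBernoulli p).real (capIn a (V i)) :=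
        prod_le_prod (fun i _ => measureReal_nonneg) fun i _ =>
          measureReal_mono fun ω hω => (subset_capIn_inter_capOut a (hV i) hω).1
    _ = ∏ i, (prodBernoulli fun i => p (f i)).real (V₀ i) := prod_congr rfl fun i _ => hre i
    _ ≤ ((prodBernoulli fun i => p (f i)).real A₀) ^ (k - 1) := key
    _ = ((prodBernoulli p).real (cylEv f A₀)) ^ (k - 1) := by rw [real_cylEv]

end SafeCalc

end Summit.CriticalPhenomena.PercolationContinuityZ3.Theorems.SunflowerPartition
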